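import Summits.BirchSwinnertonDyer.BirchSwinnertonDyer.Theorems.ManinLocalTwoThreeManinPrimeToAdditiveFiveLeUnstarredLawOfAcrossIsogeny
import Summits.BirchSwinnertonDyer.BirchSwinnertonDyer.Theorems.ManinLocalTwoThreeManinPrimeToAdditiveFiveLeDegreeUpThirteenOfOrdinaryTwistLaw
import Summits.BirchSwinnertonDyer.BirchSwinnertonDyer.Theorems.ManinLocalTwoThreeManinPrimeToAdditiveFiveLeKatoReductionFiveLe
import Summits.BirchSwinnertonDyer.BirchSwinnertonDyer.Theorems.ManinLocalTwoThreeManinPrimeToAdditiveFiveLeReducibleResidueSharp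
import Summits.BirchSwinnertonDyer.BirchSwinnertonDyer.Theorems.ManinLocalTwoThreeManinPrimeToAdditiveFiveLeReducibleResidueThirteenStub
import Summits.BirchSwinnertonDyer.BirchSwinnertonDyer.Theorems.ManinLocalTwoThreeManinPrimeToAdditiveFiveLeRedFiveTypeIIFlipTwin
import HarnessLib

/-!
# Route `ManinLocalTwoThree`, residual crux C5 `ManinPrimeToAdditiveFiveLe`
# (stmt-BirchSwinnertonDyer-22969), line `upper_anchor`: **the by-name ledger after υ/υ2 — C5 from EIGHT
# cite-only printed facts, KP57, the ANCHOR stub, and the imc cell's two registered conjectures E-imc-5 (at 5, 7)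
# and E-imc-9 (at 13)**

Width seat bsd-line-ml23-c5-p1-w2 (gen 4), piece υ3 (HOME STATUS 2026-08-28). One theorem, no new mathematics: the
composition `ManinPrimeToAdditiveFiveLe_of` of skeleton v8 (`Cruxes/ManinPrimeToAdditiveFiveLe/Lines/upper_anchor.lean`,
sha16 f41b6313bdbd3fbd) with its two optimality stubs DISCHARGED from the imc planner's `@[conjecture]` leaves by
this seat's υ (p626338, `optimalUnstarredNonGord57_of_acrossIsogeny_of_gealyKlagsbrun`: stub U ⟸ Gealy–Klagsbrun
∧ E-imc-5 `OptimalUnstarredAcrossIsogeny 5, 7`) and υ2 (`degreeUp13Red_of_ordinaryRamifiedTwistLaw`: stub DEG13 ⟸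
E-imc-9 `OrdinaryRamifiedTwistLaw 13`). So crux C5 BY NAME ⟸

  {F″, ČNS, Cremona ≤ 5·10⁵, EdK, EdG, MazurJ, D–D 2015, GK 2017}   (eight cite-only printed facts)
  ∧ KP57 (`EdixhovenFibreFiveSeven.KPResidueManinUnitFiveSeven`, stmt-BirchSwinnertonDyer-23810)
  ∧ ANCHOR (`stub_red57unstarredOffIIAtFive` of v8: Manin for UNSTARRED `W[p]`-reducible optimal curves at
    (5; III), (5; IV), (7; II), (7; III), (7; IV) — open mathematics, promoted crux-sized by the lead gen 4)
  ∧ `OptimalUnstarredAcrossIsogeny 5` ∧ `OptimalUnstarredAcrossIsogeny 7` (E-imc-5) ∧ `OrdinaryRamifiedTwistLaw 13` (E-imc-9).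

Every optimality / degree law consumed is now a REGISTERED conjecture of the cell (refuter-vetted: E-imc-5 REF1
SURVIVES 14:02Z, E-imc-9 REF1 SURVIVES 16:22Z, 2026-08-27), not a statement private to the line. HONEST STATUS:
conditional-result helper (`--supports … --as helper`); the ANCHOR, KP57, E-imc-5, E-imc-9 are OPEN; eight inputs are
cite-only. Nothing here proves BSD, Manin's conjecture or C5.

References: [Kato2004Asterisque] (8.1.3), Thm. 9.7; [CesnaviciusNeururerSaha2023] Thm. 1.2; [EdixhovenManin1991] Thm. 3;
[Mazur1978] Thm. 1; [DokchitserDokchitser2015LocalInvariants] Thm. 5.1 (1); [GealyKlagsbrun2017] Thm. 1;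
[KostersPannekoek2017] Cor. 2; cell bsd-f2-manin MEMO-imc.md §3 (E-imc-5), §10 (E-imc-9).
-/

set_option autoImplicit false
-- the Theorems namespace of this sub repeats the summit name by design (D-0017 nested layout)
set_option linter.dupNamespace false

noncomputable section

open scoped Classical NumberField

namespace Summit.BirchSwinnertonDyer.BirchSwinnertonDyer.Theorems

open WeierstrassCurve IsDedekindDomain NumberField
  Literature.NumberTheory.EllipticCurves Literature.NumberTheory.EllipticCurves.ModularForms
  Summit.BirchSwinnertonDyer.Rank1Residual.ManinAdditive
  Summit.BirchSwinnertonDyer.Rank1Residual.Additive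
  Summit.BirchSwinnertonDyer.BirchSwinnertonDyer.Theses.EdixhovenFibreFiveSeven

/-- **C5 BY NAME ⟸ eight cite-only printed facts ∧ KP57 ∧ the ANCHOR stub of skeleton v8 ∧ E-imc-5 at 5 and 7 ∧
E-imc-9 at 13.** The composition of skeleton v8 (`maninPrimeToAdditiveFiveLe_of_kato57_print_of_kp57_of_reducibleCores`,
p611587, fed with p612504 / p617914 / p622240 / p612408 / p614544 / p618203) with `stub_optimalUnstarredNonGord57`
replaced by υ (p626338) and `stub_degreeUp13Red` by υ2. `hA` is v8's `stub_red57unstarredOffIIAtFive` VERBATIM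
(open). Conditional result; closes nothing.
[cite: EdixhovenManin1991, Thm. 3] [cite: CesnaviciusNeururerSaha2023, Thm. 1.2] [cite: GealyKlagsbrun2017, Thm. 1]
[cite: DokchitserDokchitser2015LocalInvariants, Thm. 5.1 (1)] -/
theorem maninPrimeToAdditiveFiveLe_of_prints_of_kp57_of_anchor_of_imcLaws
    (hK57 : kato_neron_isIntegral_twistedSymbolSum_of_additive_five_le)
    (hCNS : cesnaviciusNeururerSaha_padicVal_maninConstant_le_modularDegree)
    (h500k : cremona_abs_maninConstant_eq_one_of_level_le_500000)
    (hEdK : edixhoven_not_dvd_maninConstant_of_kodairaSymbol_ne)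
    (hEdG : edixhoven_not_dvd_maninConstant_of_not_potentiallyGoodOrdinary)
    (hJ : mazur_j_mem_of_not_hasIrreducibleModPGaloisRep_of_eleven_le)
    (hDD : dokchitser_padicValInt_minimalDiscriminantInt_eq_of_isogeny_of_potentiallyGoodOrdinary)
    (hGK : gealyKlagsbrun2017_neronScalar_of_additive_potSupersingular)
    (hKP57 : KPResidueManinUnitFiveSeven)
    (hA : mazur_not_dvd_maninConstant_of_odd → abbesUllmo_not_dvd_maninConstant_of_not_dvd_level →
      cesnavicius_not_two_dvd_maninConstant_of_two_dvd_level → exists_isNewformOf →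
      ∀ (W : WeierstrassCurve ℚ) [W.IsElliptic] [W.IsGloballyMinimal] [NeZero (W.conductorNorm ℤ)]
        (D : ModularParametrizationData W (W.conductorNorm ℤ)),
        IsLatticeOptimal D → ∀ (p : ℕ) (hp : p.Prime), (p = 5 ∨ p = 7) → p ^ 2 ∣ W.conductorNorm ℤ →
        ¬ (∃ (W' : WeierstrassCurve ℚ) (q : ℕ), W'.IsElliptic ∧ W'.IsGloballyMinimal ∧ q.Prime ∧
            q ≠ 2 ∧ q ^ 2 ∣ W.conductorNorm ℤ ∧
            IsIsogenous W (W'.quadraticTwist (((-1 : ℤ) ^ (q / 2) * q : ℤ) : ℚ)) ∧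
            ¬ q ^ 2 ∣ W'.conductorNorm ℤ) →
        ¬ (∃ (W' : WeierstrassCurve ℚ) (d : ℤ), W'.IsElliptic ∧ W'.IsGloballyMinimal ∧
            (d = -1 ∨ d = 2 ∨ d = -2) ∧ 2 ^ 2 ∣ W.conductorNorm ℤ ∧
            IsIsogenous W (W'.quadraticTwist (d : ℚ)) ∧ ¬ 2 ^ 2 ∣ W'.conductorNorm ℤ) →
        ¬ W.HasIrreducibleModPGaloisRep p →
        500000 < W.conductorNorm ℤ →
        p ∣ D.modularDegree →
        (∀ n : ℕ, W.kodairaSymbolAt ((Rat.HeightOneSpectrum.primesEquiv (R := ℤ)).symm ⟨p, hp⟩) ≠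
          .Istar n) →
        padicValInt p W.minimalDiscriminantInt ≤ 4 →
        (p = 5 → padicValInt p W.minimalDiscriminantInt ≠ 2) →
        ¬ (p : ℤ) ∣ D.maninConstant)
    (hE5 : OptimalUnstarredAcrossIsogeny 5) (hE7 : OptimalUnstarredAcrossIsogeny 7)
    (hO13 : OrdinaryRamifiedTwistLaw 13) :
    Summit.BirchSwinnertonDyer.BirchSwinnertonDyer.Theses.ManinLocalTwoThree.ManinPrimeToAdditiveFiveLe :=
  maninPrimeToAdditiveFiveLe_of_kato57_print_of_kp57_of_reducibleCores hK57 hCNS h500k hEdK hEdG hKP57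
    (coreRED57_of_cns_cremona_of_coreRED57sharp hCNS h500k
      (coreRED57sharp_of_cns_of_unstarred_of_bistarred hCNS
        (coreRED57unstarred_of_cns_of_offTypeIIAtFive_of_typeIIAtFiveCorner hCNS hA
          (typeIIAtFiveCorner_of_acrossIsogeny_of_gealyKlagsbrun hGK hE5 hE7))
        (red57bistarred_of_dokchitser_of_acrossIsogeny_of_gealyKlagsbrun hDD hGK hE5 hE7)))
    (coreRED11_of_mazurJ_of_coreRED13 hJ
      (coreRED13_of_cremona_of_coreRED13sharp h500k
        (red13sharp_of_edixhovenKodairaFact_of_ordinaryRamifiedTwistLaw hEdK hO13)))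

end Summit.BirchSwinnertonDyer.BirchSwinnertonDyer.Theorems

end
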